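import Literature.Barriers.CriticalPhenomena.PositionSpaceRGNonGibbsianSpacing
import Literature.Probability.LatticeModels.IsingBoundaryMonotonicity
import HarnessLib

/-!
# Barrier `PositionSpaceRGNonGibbsian`, Theorem 4.3: the finite-volume estimate reduced to two
# extremal boundary conditions (the FKG step of van Enter–Fernández–Sokal eq. (4.26))

Third companion file of `Literature/Barriers/CriticalPhenomena/PositionSpaceRGNonGibbsian.lean`.
`PositionSpaceRGNonGibbsianSpacing.lean` reduced Theorem 4.3 (`NonGibbs.VEFS1993_thm43`) to the
named fact `NonGibbs.VEFS1993_eq413_spacing`: uniform bounds on the finite-volume zero-field Ising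
expectation `⟨σ_0⟩^η_{W;β,0}` over ALL boundary conditions `η` whose decimation lies in the
phase-selecting sets `𝒩_{R,R',±}`. Here the quantification over boundary conditions is removed,
exactly as in the printed proof: by the FKG monotonicity of finite-volume expectations in the
boundary condition (Friedli–Velenik 2017, Exercise 3.13 / Lemma 3.23, the tree's
`isingExpect_fixed_mono`), the worst cases are the two EXTREMAL boundary conditions — image spins
as prescribed by `𝒩_{R,R',+}` and every other spin `-1`, respectively image spins as prescribed
by `𝒩_{R,R',-}` and every other spin `+1`. This is the first inequality in each of
van Enter–Fernández–Sokal's (4.26) and (4.27): "`⟨σ_i⟩^{±,+,σ}_{R,R'} ≥ ⟨σ_i⟩^{±,+,-}_{R,R'}`" and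
"`⟨σ_i⟩^{±,-,σ}_{R,R'} ≤ ⟨σ_i⟩^{±,-,+}_{R,R'}`" (§4.3.1 Step 2, p. 109: bounds "for every
configuration `σ` outside `Λ_{R'}`", "This will be proven using correlation inequalities together
with the uniqueness of the Gibbs measure for the internal-spin system with image spins set to all
`+` or all `-`"; the comparison with the all-`-` [all-`+`] exterior is the FKG monotonicity in
the boundary condition).

## What is formalised (namespace `Literature.Barriers.CriticalPhenomena.NonGibbs`)

* `coreAnnulusBC d b R R' s_ann s_out` — the extremal boundary conditions: on the image sites
  `bx`, `ω'_alt(x)` for `x ∈ Λ_R` and `s_ann` for `x ∈ Λ_{R'} ∖ Λ_R`; `s_out` at every other site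
  (image sites outside `Λ_{R'}` and all internal sites). Its decimation is `ω'_alt` on `Λ_R`,
  `s_ann` on the annulus, `s_out` outside (`decimate_coreAnnulusBC`), so it lies in `𝒩_{R,R',+}`
  for `s_ann = +1` and in `𝒩_{R,R',-}` for `s_ann = -1`; and every `η` with
  `T_bη ∈ 𝒩_{R,R',+}` dominates `coreAnnulusBC d b R R' 1 (-1)` coordinatewise
  (`coreAnnulusBC_le_of_mem_plusSelected`), dually for `𝒩_{R,R',-}`.
* Named fact `VEFS1993_eq413_extremal` — the second inequalities of (4.26)–(4.27) with Step 3,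
  i.e. `VEFS1993_eq413_spacing` specialised to the two extremal boundary conditions: for `d ≥ 2`,
  `b ≥ 2`, `β > J₀(d,b)` there is `δ > 0` such that for every `R` there are `R' > R` and a finite
  volume `W ∋ 0` free of other image sites with
  `⟨σ_0⟩^{η(+1,-1)}_{W;β,0} - ⟨σ_0⟩^{η(-1,+1)}_{W;β,0} ≥ δ`.
* PROVED: `VEFS1993_eq413_spacing_of_extremal` (FKG), its converse
  `VEFS1993_eq413_extremal_of_spacing`, the equivalence `VEFS1993_eq413_extremal_iff`, and the
  assembly `VEFS1993_thm43_of_extremal : VEFS1993_eq413_extremal → VEFS1993_thm43`.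

What remains for `VEFS1993_thm43_holds` is `VEFS1993_eq413_extremal`: a statement about two
explicit finite-volume nearest-neighbour Ising expectations per `(R, R')` (low-temperature
analysis of the internal-spin system: Pirogov–Sinai theory, van Enter–Fernández–Sokal App. B.5.3).
-/

noncomputable section

namespace Literature.Barriers.CriticalPhenomena.NonGibbs

open MeasureTheory Literature.Probability.LatticeModels

variable {d : ℕ}

/-! ### The extremal boundary conditions -/

/-- **The extremal boundary conditions of the Griffiths–Pearce–Israel estimate.** On an image
site `y = bx` (all coordinates of `y` divisible by `b`): the alternating value `ω'_alt(x)` if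
`x ∈ Λ_R`, the annulus value `s_ann` if `x ∈ Λ_{R'} ∖ Λ_R`; the value `s_out` at every other
site — image sites outside `Λ_{R'}` AND all internal sites ("the spins outside `Λ_{R'}` (both
image and internal) fixed", van Enter–Fernández–Sokal §4.3.1 Step 2, with the internal-spin
boundary condition also frozen to `s_out`; the systems `Ω^{±,+,-}_{R,R'}`, `Ω^{±,-,+}_{R,R'}` of
eqs. (4.26)–(4.27) are `s_ann = +1, s_out = -1` and `s_ann = -1, s_out = +1`).
[cite: VanenterFernandezSokal1993, §4.3.1 Step 2, eqs. (4.26)–(4.27)] -/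
def coreAnnulusBC (d b R R' : ℕ) (s_ann s_out : ℤˣ) : SpinConfig (Site d) :=
  open Classical in
  fun y =>
    if (∀ i, (b : ℤ) ∣ y i) ∧ (fun i => y i / b) ∈ box d R then altConfig d (fun i => y i / b)
    else if (∀ i, (b : ℤ) ∣ y i) ∧ (fun i => y i / b) ∈ box d R' then s_ann else s_out

/-- The value of `coreAnnulusBC` at an image site `bx`.
[cite: VanenterFernandezSokal1993, §4.3.1 Step 2] -/
theorem coreAnnulusBC_apply_image {b : ℕ} (hb : 0 < b) (R R' : ℕ) (s_ann s_out : ℤˣ)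
    (x : Site d) :
    coreAnnulusBC d b R R' s_ann s_out (fun i => (b : ℤ) * x i) =
      open Classical in
      if x ∈ box d R then altConfig d x else if x ∈ box d R' then s_ann else s_out := by
  have hb' : (b : ℤ) ≠ 0 := by exact_mod_cast hb.ne'
  have hdiv : ∀ i, (b : ℤ) ∣ (b : ℤ) * x i := fun i => dvd_mul_right _ _
  have hquot : (fun i => (b : ℤ) * x i / b) = x := funext fun i => Int.mul_ediv_cancel_left _ hb'
  unfold coreAnnulusBC
  simp only [hdiv, implies_true, true_and, hquot]

/-- **The decimation of the extremal boundary condition**: `ω'_alt` on `Λ_R`, `s_ann` on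
`Λ_{R'} ∖ Λ_R`, `s_out` outside `Λ_{R'}`. [cite: VanenterFernandezSokal1993, §4.3.1 Step 2, eq. (4.25)] -/
theorem decimate_coreAnnulusBC {b : ℕ} (hb : 0 < b) (R R' : ℕ) (s_ann s_out : ℤˣ) (x : Site d) :
    decimate d b (coreAnnulusBC d b R R' s_ann s_out) x =
      open Classical in
      if x ∈ box d R then altConfig d x else if x ∈ box d R' then s_ann else s_out := by
  rw [decimate_apply]
  exact coreAnnulusBC_apply_image hb R R' s_ann s_out x

/-- The extremal `+`-annulus boundary condition selects `𝒩_{R,R',+}`.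
[cite: VanenterFernandezSokal1993, eq. (4.25a)] -/
theorem decimate_coreAnnulusBC_mem_plusSelected {b : ℕ} (hb : 0 < b) (R R' : ℕ) (s_out : ℤˣ) :
    decimate d b (coreAnnulusBC d b R R' 1 s_out) ∈ plusSelected d R R' := by
  classical
  refine ⟨fun x hx => ?_, fun x hx hxR => ?_⟩
  · rw [decimate_coreAnnulusBC hb]; simp [hx]
  · rw [decimate_coreAnnulusBC hb]; simp [hx, hxR]

/-- The extremal `-`-annulus boundary condition selects `𝒩_{R,R',-}`.
[cite: VanenterFernandezSokal1993, eq. (4.25b)] -/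
theorem decimate_coreAnnulusBC_mem_minusSelected {b : ℕ} (hb : 0 < b) (R R' : ℕ) (s_out : ℤˣ) :
    decimate d b (coreAnnulusBC d b R R' (-1) s_out) ∈ minusSelected d R R' := by
  classical
  refine ⟨fun x hx => ?_, fun x hx hxR => ?_⟩
  · rw [decimate_coreAnnulusBC hb]; simp [hx]
  · rw [decimate_coreAnnulusBC hb]; simp [hx, hxR]

/-- Every spin is `≥ -1` and `≤ +1`; an image site `y` (all coordinates divisible by `b`) is
`b · (y/b)`. Hence: **every boundary condition whose decimation lies in `𝒩_{R,R',+}` dominates the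
extremal one** `coreAnnulusBC d b R R' 1 (-1)` coordinatewise (they agree on the prescribed image
sites, and `-1` is minimal elsewhere) — the comparison "`⟨σ_i⟩^{±,+,σ} ≥ ⟨σ_i⟩^{±,+,-}`" of (4.26)
at the level of configurations. [cite: VanenterFernandezSokal1993, §4.3.1 eq. (4.26)] -/
theorem coreAnnulusBC_le_of_mem_plusSelected {b : ℕ} (hb : 0 < b) {R R' : ℕ}
    {η : SpinConfig (Site d)} (hη : decimate d b η ∈ plusSelected d R R') :
    coreAnnulusBC d b R R' 1 (-1) ≤ η := by
  classical
  intro y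
  by_cases hdiv : ∀ i, (b : ℤ) ∣ y i
  · -- `y = b · x` is an image site
    set x : Site d := fun i => y i / b with hx
    have hy : y = fun i => (b : ℤ) * x i := funext fun i => (Int.mul_ediv_cancel' (hdiv i)).symm
    rw [hy, coreAnnulusBC_apply_image hb]
    have himg : η (fun i => (b : ℤ) * x i) = decimate d b η x := by rw [decimate_apply]
    rw [himg]
    by_cases hxR : x ∈ box d R
    · simp only [hxR, if_true]
      exact (hη.1 x hxR).symm.le
    · by_cases hxR' : x ∈ box d R'
      · simp only [hxR, if_false, hxR', if_true]
        exact (hη.2 x hxR' hxR).symm.le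
      · simp only [hxR, if_false, hxR']
        exact neg_one_le_intUnits _
  · unfold coreAnnulusBC
    simp only [hdiv, false_and, if_false]
    exact neg_one_le_intUnits _

/-- Dually, every boundary condition whose decimation lies in `𝒩_{R,R',-}` is dominated by the
extremal one `coreAnnulusBC d b R R' (-1) 1` — the comparison "`⟨σ_i⟩^{±,-,σ} ≤ ⟨σ_i⟩^{±,-,+}`" of
(4.27). [cite: VanenterFernandezSokal1993, §4.3.1 eq. (4.27)] -/
theorem le_coreAnnulusBC_of_mem_minusSelected {b : ℕ} (hb : 0 < b) {R R' : ℕ}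
    {η : SpinConfig (Site d)} (hη : decimate d b η ∈ minusSelected d R R') :
    η ≤ coreAnnulusBC d b R R' (-1) 1 := by
  classical
  intro y
  by_cases hdiv : ∀ i, (b : ℤ) ∣ y i
  · set x : Site d := fun i => y i / b with hx
    have hy : y = fun i => (b : ℤ) * x i := funext fun i => (Int.mul_ediv_cancel' (hdiv i)).symm
    rw [hy, coreAnnulusBC_apply_image hb]
    have himg : η (fun i => (b : ℤ) * x i) = decimate d b η x := by rw [decimate_apply]
    rw [himg]
    by_cases hxR : x ∈ box d R
    · simp only [hxR, if_true]
      exact (hη.1 x hxR).le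
    · by_cases hxR' : x ∈ box d R'
      · simp only [hxR, if_false, hxR', if_true]
        exact (hη.2 x hxR' hxR).le
      · simp only [hxR, if_false, hxR']
        exact intUnits_le_one _
  · unfold coreAnnulusBC
    simp only [hdiv, false_and, if_false]
    exact intUnits_le_one _

/-! ### The named fact: the estimate for the two extremal boundary conditions -/

/-- **van Enter–Fernández–Sokal 1993, eqs. (4.26)–(4.27) (second inequalities) with Step 3, for
decimation with spacing `b`: the finite-volume Griffiths–Pearce–Israel estimate for the two
extremal boundary conditions.** For `d ≥ 2` and `b ≥ 2` there is `J₀ = J₀(d,b)` such that for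
every `β > J₀` there is `δ > 0` with: for every `R` there are `R' > R` and a finite set `W` of
original sites containing the origin and no other image site `bx` (`x ≠ 0`) — in the source the
internal spins of `Λ_{R'}` together with the origin — such that the zero-field finite-volume Ising
expectations of the spin at the origin in `W` under the two extremal boundary conditions
(image spins `ω'_alt` on `Λ_R`; `+1` on the annulus `Λ_{R'} ∖ Λ_R` and `-1` everywhere else,
respectively `-1` on the annulus and `+1` everywhere else) differ by at least `δ`:
`⟨σ_0⟩^{±,+,-}_{W;β,0} - ⟨σ_0⟩^{±,-,+}_{W;β,0} ≥ δ`. Printed as (4.26) "for `J` sufficiently large,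
there exists `c > 0` such that for all `R > 0` there exists `R' > R` (depending on `R`) such that
`⟨σ_i⟩^{±,+,σ}_{R,R'} ≥ ⟨σ_i⟩^{±,+,-}_{R,R'} ≥ c > 0`", (4.27) "`⟨σ_i⟩^{±,-,σ}_{R,R'} ≤
⟨σ_i⟩^{±,-,+}_{R,R'} ≤ -c < 0`" (internal spins `i ∈ Λ^int_R`, origin fixed), followed by Step 3
(unfixing of the origin, (4.13)) and, for `b ≥ 3`, §4.3.2 ("Steps 2 and 3 are then proven in a
manner exactly identical to the `b = 2` case", Step 1 by Pirogov–Sinai theory, App. B.5.3).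
Equivalent to `VEFS1993_eq413_spacing` by FKG monotonicity in the boundary condition
(`VEFS1993_eq413_extremal_iff`). Named fact, not proved here.
[cite: VanenterFernandezSokal1993, §4.3.1 eqs. (4.26)–(4.27), §4.1.2 Step 3, §4.3.2] -/
def VEFS1993_eq413_extremal : Prop :=
  ∀ d b : ℕ, 2 ≤ d → 2 ≤ b → ∃ J₀ : ℝ, ∀ β : ℝ, J₀ < β → ∃ δ : ℝ, 0 < δ ∧
    ∀ R : ℕ, ∃ R' : ℕ, R < R' ∧ ∃ W : Finset (Site d), (0 : Site d) ∈ W ∧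
      (∀ x : Site d, x ≠ 0 → (fun i => (b : ℤ) * x i) ∉ W) ∧
      δ ≤ isingExpect (zdGraph d) W β 0 (.fixed (coreAnnulusBC d b R R' 1 (-1))) (spinAt 0) -
        isingExpect (zdGraph d) W β 0 (.fixed (coreAnnulusBC d b R R' (-1) 1)) (spinAt 0)

/-! ### The FKG reduction and its converse -/

/-- **`VEFS1993_eq413_spacing` from the extremal estimate (the FKG step of (4.26)–(4.27)).**
For `β ≥ 0` the finite-volume expectation of the nondecreasing observable `σ_0` is nondecreasing
in the boundary condition (`isingExpect_fixed_mono`, Friedli–Velenik Exercise 3.13 from the FKG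
inequality), and every `η` with `T_bη ∈ 𝒩_{R,R',+}` [resp. `𝒩_{R,R',-}`] dominates [is dominated
by] the extremal boundary condition; so `c₊ = ⟨σ_0⟩^{±,+,-}_W`, `c₋ = ⟨σ_0⟩^{±,-,+}_W` serve as the
uniform levels (the threshold is raised to `max J₀ 0` to have `β ≥ 0`).
[cite: VanenterFernandezSokal1993, §4.3.1 eqs. (4.26)–(4.27) and Step 2.3] -/
theorem VEFS1993_eq413_spacing_of_extremal (h : VEFS1993_eq413_extremal) :
    VEFS1993_eq413_spacing := by
  intro d b hd hb
  obtain ⟨J₀, hJ⟩ := h d b hd hb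
  refine ⟨max J₀ 0, fun β hβ => ?_⟩
  have hβ0 : 0 ≤ β := (le_max_right J₀ 0).trans hβ.le
  have hb0 : 0 < b := by omega
  obtain ⟨δ, hδ, hR⟩ := hJ β ((le_max_left J₀ 0).trans_lt hβ)
  refine ⟨δ, hδ, fun R => ?_⟩
  obtain ⟨R', hRR', W, h0, hW, hgap⟩ := hR R
  refine ⟨R', hRR', W, h0, hW, _, _, hgap, fun η hη => ?_, fun η hη => ?_⟩
  · exact isingExpect_fixed_mono (zdGraph d) hβ0 W 0 (coreAnnulusBC_le_of_mem_plusSelected hb0 hη)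
      (spinAt_mono 0) (measurable_spinAt 0)
  · exact isingExpect_fixed_mono (zdGraph d) hβ0 W 0 (le_coreAnnulusBC_of_mem_minusSelected hb0 hη)
      (spinAt_mono 0) (measurable_spinAt 0)

/-- **Converse: the extremal estimate from `VEFS1993_eq413_spacing`** (the extremal boundary
conditions are admissible: their decimations lie in `𝒩_{R,R',±}`), so nothing is lost in the
reduction. [cite: VanenterFernandezSokal1993, §4.3.1 eqs. (4.26)–(4.27)] -/
theorem VEFS1993_eq413_extremal_of_spacing (h : VEFS1993_eq413_spacing) :
    VEFS1993_eq413_extremal := by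
  intro d b hd hb
  obtain ⟨J₀, hJ⟩ := h d b hd hb
  refine ⟨J₀, fun β hβ => ?_⟩
  have hb0 : 0 < b := by omega
  obtain ⟨δ, hδ, hR⟩ := hJ β hβ
  refine ⟨δ, hδ, fun R => ?_⟩
  obtain ⟨R', hRR', W, h0, hW, cplus, cminus, hgap, hplus, hminus⟩ := hR R
  refine ⟨R', hRR', W, h0, hW, hgap.trans ?_⟩
  have h1 := hplus _ (decimate_coreAnnulusBC_mem_plusSelected (d := d) hb0 R R' (-1))
  have h2 := hminus _ (decimate_coreAnnulusBC_mem_minusSelected (d := d) hb0 R R' 1)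
  linarith

/-- The two finite-volume forms of the Griffiths–Pearce–Israel estimate are equivalent.
[cite: VanenterFernandezSokal1993, §4.3.1 eqs. (4.26)–(4.27)] -/
theorem VEFS1993_eq413_extremal_iff : VEFS1993_eq413_extremal ↔ VEFS1993_eq413_spacing :=
  ⟨VEFS1993_eq413_spacing_of_extremal, VEFS1993_eq413_extremal_of_spacing⟩

/-- **Theorem 4.3 from the extremal finite-volume estimate**: `VEFS1993_eq413_extremal` (named
fact: low-temperature analysis of two explicit finite-volume systems) ⟹ `VEFS1993_eq413_spacing`
(FKG, proved) ⟹ (4.32) for spacing `b` (DLR transfer, proved) ⟹ Theorem 4.3 (conclusion of the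
argument, proved). [cite: VanenterFernandezSokal1993, Theorem 4.3] -/
theorem VEFS1993_thm43_of_extremal (h : VEFS1993_eq413_extremal) : VEFS1993_thm43 :=
  VEFS1993_thm43_of_eq413 (VEFS1993_eq413_spacing_of_extremal h)

end Literature.Barriers.CriticalPhenomena.NonGibbs

end
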